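import Summits.BirchSwinnertonDyer.Rank1Residual.O5.HeegnerLogTransportThreeStepZeroEnd
import Summits.BirchSwinnertonDyer.Rank1Residual.O5.HeegnerLogTransportThreeOrdCompanionIndex
import Summits.BirchSwinnertonDyer.Rank1Residual.O5.HeegnerLogTransportThreeRatLogUnit
import HarnessLib
import HarnessLib.Audit.Tags

/-!
# Heegner-log transport at `p = 3` (KL3), part 25: the TWO-SIDED END of record — GEN 18's good-ordinary
# companion chain (no residual Selmer passage, hence NO local-torsion binder `htℓ`) brought to the GEN 22
# `_cited_s0d` standard (Kriz–Li cited, STEP-0 discharged, `Ш` by two `3`-descents) — o5-r2 GEN 27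

HONEST FRAMING (cell `b2b-bsdres`, run/shared/lean/b2b/bsd-rank1-residual/, verbatim in every file): the
goal of the cell is to DELETE the COMBINATION-SHAPED residual classes of the Birch–Swinnerton-Dyer formula
for ALL analytic-rank `≤ 1` elliptic curves over `ℚ` — "full BSD formula for every rank `≤ 1` curve in
class `C`" assembled STRICTLY from published theorems — so that the rank-`≤ 1` remainder becomes exactly
the CONSTRUCTION-SHAPED classes, which are TYPED (missing-input `Prop`s), NOT attempted. This is not
"finishing BSD". Team O5 (tame potentially supersingular additive `p = 3`, (t′)), planner o5-r2 (the
non-Iwasawa side), GEN 27; RESEARCH ROUTE; THEOREMS ONLY (bookkeeping over explicit hypotheses): no new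
node is WANTED, no Literature fact, no `@[conjecture]`, no new object; NOTHING is booked and no mark of
`RESIDUAL-MAP.md` moves. O5 OPEN.

## Why this file (memo `HOME/b2b-bsdres-o5-r2/gen27/O5-GEN27.md`, census EVIDENCE
## `gen27/census/KL3-END-eligibility-o5r2-g27.tsv`)

The END of record of GEN 22–26 (`o5_index_unit_of_ordinary_companion_cited_s0g` and every `_s0*` /
`_facts*` member of that family) carries the binder
`htℓ : ∀ ℓ ≠ 3, ℓ ∣ N_W N_G → NoLocalThreeTorsionAt W ℓ` (`H⁰(ℚ_ℓ, ρ̄) = 0` at EVERY bad prime of either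
curve), inherited from the RESIDUAL Selmer passage `Sel_𝔭(K, W[3^∞]) = 0 ⇒ Sel_𝔭(K, G[3^∞]) = 0` (parts 7–10):
at a bad `ℓ ≠ 3` the mod-`3` local condition is the Kummer line `X(K_w)[3^∞]/3 ⊂ H¹(K_w, ρ̄)`, which is
curve-independent only when it is `0`. The GEN 27 census of ALL 870 KL3 pairs (363 (t′) curves `W`, exact
integer arithmetic on Cremona's models) finds that the finitary binders of that END hold SIMULTANEOUSLY on
0 / 870 pairs: `3 ∤ ∏c(W)` leaves 44, a good-ORDINARY companion leaves 17, and `htℓ` kills 15 of those 17 —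
in each of the three pairs whose BSD-predicted `3`-index is a unit (`240930b1 ~ 26770a1`, `149895d1 ~ 16655c1`,
`430425o1 ~ 47825d1`; census currencies `𝓛_E = 𝓛_G = 0`) the failing `ℓ` is a COMMON multiplicative prime
with `a_ℓ(W) = a_ℓ(G)` and `3 ∣ |W̃^{ns}(𝔽_ℓ)| = ℓ ∓ 1` (`ℓ = 2, 2677`; `5`; `1913`), i.e. a prime of
Kriz–Li's `M`, where Thm. 1.16 needs nothing; the remaining 2 of 17 have `d_E = 1` (no unit-log point,
BSD-predicted `3 ∣` index — the END is correctly silent). So the A-family END is VACUOUS on the census.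

GEN 18's chain with the `Ш` / unit-log hypotheses on the COMPANION side
(`o5_index_unit_of_goodOrd_companion_of_kolyvagin`, `O5/HeegnerLogTransportThreeOrdCompanionIndex.lean`) has
no residual passage and no `htℓ`. THIS file brings it to the standard of the GEN 22 END of record:
(i) KL3-A is Kriz–Li Thm. 1.16 BY NAME (`hKL`, part 14's glue
`krizLiUnitBitTransportThree_of_thm116_of_exists_isNewformOf`); (ii) STEP-0 (`q₀`, `q₁`, `hstep0`, row C16
for the companion pair, analytic ranks `≤ 1`, finite index of `P′`) is DISCHARGED exactly as in
`o5_index_unit_of_ordinary_companion_facts_s0` (Yan–Zhu on row C16, part 17's Gross–Zagier bookkeeping,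
Kolyvagin); (iii) the two analytic-order binders `hu₀`, `hu₁` are replaced by `#Ш(G/K)[3^∞] = 1`, itself
DISCHARGED by the companion pair's two sharp `3`-descents over `ℚ` (`hSelG`, `hSelGd`; part 19's
`hshaW_of_threeDescent`, the torsion hypotheses coming from row C16's irreducibility); (iv) (§2) the
unit-log datum is a RATIONAL point `Q₀ ∈ G(ℚ)` of infinite order whose `ℚ₃`-logarithm has the minimal
valuation `1 − v₃|G̃(𝔽₃)|` (part 12), a kernel-certifiable per-row statement (made a KERNEL CERTIFICATE — rational
multiple + tree ladder — in part 25b `O5/HeegnerLogTransportThreeStepZeroEndTwoSidedCert.lean`). Net binders of the two-sided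
END: published theorems BY NAME (`hKL`, `hYZ`, `hW20`, `hmod`, `hGZK`, `hKoG`, `hGZG`), the Heegner data of
the pair, and per-row data ALL of which are decidable certificates or descents: `hcong`, `hρ`, `hadd`,
`hunitW`, `hunitG`, `htam`, `htamG`, `htamGd`, `hordG`, Manin units, `hSelG`, `hSelGd`, the unit-log point —
and NO `htℓ`, `ht3`, `hK3`, `hPT`, `hEP`, `hSelW`, `hSelWt`, `hQW`. On the census its finitary binders hold
on the three `𝓛 = 0` pairs above (EVIDENCE; `htamGd` for the two even `d_K` by Tate's algorithm at `2` is
part of the GEN 27 census note), where the A-family END cannot fire.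

## TYPER PLACEMENT NOTE

Place as `O5/HeegnerLogTransportThreeStepZeroEndTwoSided.lean` AFTER parts 12
(`O5/HeegnerLogTransportThreeRatLogUnit.lean`), GEN 18's `O5/HeegnerLogTransportThreeOrdCompanionIndex.lean`
and GEN 22's `O5/HeegnerLogTransportThreeStepZeroEnd.lean`, all in the tree, which this file imports;
THEOREMS only, namespace `Summit.BirchSwinnertonDyer.Rank1Residual.O5.HeegnerLogTransport`; no `def`.
CONTENT LABELS: THEOREMS ONLY — 0 `def`, 0 `@[conjecture]`, 0 Literature facts (net named-fact debt 0),
no `sorry`; published inputs stay displayed hypotheses BY NAME. HONEST FRAMING as above; census = EVIDENCE,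
never a Literature fact; O5 OPEN; nothing booked.

### cc-typer-5 GEN 20 (O5 §3.5 / O6 §3.4 typer of record) — by-name ask A-O5-G27-1 of o5-r2 GEN 27, HOME/INBOX.md l.14993: 'PART 25 e7e96b464eb0a381 → NEW leaf
`O5/HeegnerLogTransportThreeStepZeroEndTwoSided.lean` THEN 25b 21a4ca507ba962b9 → `O5/HeegnerLogTransportThreeStepZeroEndTwoSidedCert.lean` THEN 25c d313241b3ce88d9b →
`O5/HeegnerLogTransportThreeTwoSidedRow240930b1.lean` (by sha, byte-identical + your ¶, or not at all)'; memo `HOME/b2b-bsdres-o5-r2/gen27/O5-GEN27.md` fb9f7e33bc3d18a4;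
order of record after this seat's parts 20 / 20b / 21 / (a) / 23 / 24 CORE+CERT / 24b: 25 → 25b → 25c.

Source: `HOME/b2b-bsdres-o5-r2/gen27/lean/HeegnerLogTransportThreeStepZeroEndTwoSided.lean` sha16 `e7e96b464eb0a381` (237 l.; `gen27/SHA16.txt`; o5-r2's checks: joint scratch `gen27/lean/scratch/concat_25_25b.lean`
65d6d11ff7eef336 and `concat_25_25b_25c.lean` c4142ff08f30b651 farm rc 0 / 0 warn / 0 sorry, axioms standard, dedup of 51 names clean), re-hashed by the typer right before writing;
THIS file = KL3 part 25 = the source VERBATIM + this paragraph (imports, module text, every declaration block byte-identical; script `class-closure/typer-5/gen20/g27_place.py`,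
docstring anchor asserted); imports part 18 file 1 `…StepZeroEnd` (p354679), GEN 18 B `…OrdCompanionIndex` (p344465), part 12 `…RatLogUnit` (p351404) — all in the tree; the
typer's own standalone farm check (rc 0 / 0 warnings / 0 sorries; `#print axioms` of both ENDs standard) and DEDUP (`lean search --decl` on the 2 new names: no match; nearest
names `o5_index_unit_of_goodOrd_companion[_of_kolyvagin/_selmer/_selmer_residual]` of GEN 18–20 are the un-cited B-family ancestors, distinct statements) precede the proposal.
CONTENT LABELS (source, unchanged): THEOREMS ONLY (2: `o5_index_unit_of_goodOrd_companion_cited_s0d` — the TWO-SIDED END: Kriz–Li cited (A314), STEP 0 discharged, `Ш(G/K)[3]`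
from the companion's two sharp 3-descents, NO residual-Selmer passage, hence no `htℓ` / `ht3` / `hPT` / `hEP` / `hSelW` / `hSelWt` / `hQW` of `G`'s side as listed in the
module text; `…_cited_s0d_rat` — the unit-log datum a RATIONAL point via part 12), 0 `def`, 0 `@[conjecture]`, 0 Literature facts (net named-fact debt 0), no `sorry`; published
inputs stay displayed hypotheses BY NAME (A314 Kriz–Li 1.16, Yan–Zhu 4.15, Wuthrich L20, modularity, GZK, Kolyvagin, JSW 2017 where displayed), nothing re-proved.
HONEST FRAMING (cell `b2b-bsdres`): research route, lane CLASS-CLOSURE §3.5 O5; CONDITIONAL ENDs — nothing asserted beyond the displayed binders, nothing booked, no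
mark / label / count / tier of `RESIDUAL-MAP.md` moves; census (FINDING A / B of the memo: END-eligibility 0 / 870, B-family 3 / 870) = EVIDENCE, never a Literature
fact; O5 OPEN.
-/

set_option autoImplicit false

noncomputable section

open scoped Classical

open WeierstrassCurve Literature.NumberTheory.EllipticCurves
  Literature.NumberTheory.EllipticCurves.ModularForms
  Literature.NumberTheory.EllipticCurves.Rank1Residual
  Literature.NumberTheory.EllipticCurves.Rank1Residual.Typed
open Summit.BirchSwinnertonDyer.Rank1Residual.X11b (embAt)
open Summit.BirchSwinnertonDyer.Rank1Residual.Additive.LocalLog (padicLog)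
open IsDedekindDomain (HeightOneSpectrum)
open scoped NumberField

namespace Summit.BirchSwinnertonDyer.Rank1Residual.O5.HeegnerLogTransport

/-! ## §1 The two-sided END: Kriz–Li cited, STEP-0 discharged, `Ш(G/K)` by the companion's two `3`-descents -/

/-- **O5 (t′) TWO-SIDED END of record (o5-r2 GEN 27).** For `W/ℚ` additive at `3` with `ρ̄_{W,3}` onto and
a mod-`3` congruent good-ORDINARY companion `G` (so `G`, and every minimal model `Gd` of `G^{(d_K)}`, lie in
row C16), a common Heegner field `K` (`d_K < −4`, `3` split), Heegner points `P ∈ W(K)`, `P′ ∈ G(K)` of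
infinite order, off-`3` depletion factors units on both sides, `3 ∤ ∏c(W)`, `3 ∤ ∏c(G)`, `3 ∤ ∏c(Gd)`,
Manin constants prime to `3`, a point `Q ∈ G(K)` of infinite order whose Kriz–Li-normalised `3`-adic
logarithm is a unit, and the companion pair's two sharp `3`-descents `#Sel^(3)(G/ℚ) = 3^{rank}`,
`#Sel^(3)(Gd/ℚ) = 3^{rank}` — ASSUMING ONLY published theorems BY NAME (Kriz–Li Thm. 1.16, Yan–Zhu
Thm. 4.15, Wuthrich Lemma 20, modularity, Gross–Zagier, Kolyvagin, GZK over `ℚ`): `3 ∤ [W(K) : ℤP]`.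
No local-torsion hypothesis at any bad prime, no Poitou–Tate / Euler-characteristic input, no descent on `W`.
Proof: GEN 18's companion side `goodOrd_companion_logUnit_three_of_sha` fed with the STEP-0 discharge of
GEN 22 and part 19's `Ш`-from-descent, then GEN 16's W-side `padicValNat_index_eq_zero_of_companion_unit'`
with KL3-A supplied by part 14 from `hKL`. [cite: KrizLi2019, Thm. 1.16, Rem. 1.17]
[cite: YanZhu2024MainConjNonCM, Thm. 4.15 (§4.6) = Cor. 1.4] [cite: GrossZagier1986, Thm. I.6.3 with V.§2 (pp. 310–312)]
[cite: JetchevSkinnerWan2017, §7.4.1 (arXiv:1512.06894 p. 30)] [cite: SilvermanAEC2009, Thm. X.4.2(a)]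
[cite: Wuthrich2014, Lemma 20 (p. 399)] -/
theorem o5_index_unit_of_goodOrd_companion_cited_s0d
    (hKL : KrizLi2019.thm116_padicLogHeegner_congruence)
    (hYZ : YanZhu2026.thm415_padicValRat_bsd_rank_le_one)
    (hW20 : Wuthrich2014.lemma20_surjective_threeAdic_of_semistable)
    (hmod : exists_isNewformOf) (hGZK : rank_eq_analyticRank_of_analyticRank_le_one)
    (W G : WeierstrassCurve ℚ) [W.IsElliptic] [W.IsGloballyMinimal] [G.IsElliptic] [G.IsGloballyMinimal]
    (hcong : ∀ ℓ : ℕ, ℓ.Prime → ¬ (ℓ ∣ 3 * W.conductorNorm ℤ * G.conductorNorm ℤ) →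
      ((W.LFunction ℓ : ℤ) : ZMod 3) = ((G.LFunction ℓ : ℤ) : ZMod 3))
    (hρ : W.HasSurjectiveModNGaloisRep 3) (hadd : Addv W 3)
    (hunitW : ∀ ℓ ∈ klSet W G, ℓ ≠ 3 → padicValInt 3 (nsCount W ℓ) = 0)
    (hunitG : ∀ ℓ ∈ klSet G W, ℓ ≠ 3 → padicValInt 3 (nsCount G ℓ) = 0)
    (htam : ¬ 3 ∣ W.tamagawaProduct) (htamG : ¬ 3 ∣ G.tamagawaProduct) (hordG : GoodOrd G 3)
    (Gd : WeierstrassCurve ℚ) [Gd.IsElliptic] [Gd.IsGloballyMinimal] (htamGd : ¬ 3 ∣ Gd.tamagawaProduct)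
    {N N' : ℕ} [NeZero N] [NeZero N'] (D : ModularParametrizationData W N)
    (D' : ModularParametrizationData G N')
    (K : Type) [Field K] [NumberField K] (hK : IsImaginaryQuadratic K)
    (hH : SatisfiesHeegnerHypothesis N K) (hH' : SatisfiesHeegnerHypothesis N' K)
    (h3K : SatisfiesHeegnerHypothesis 3 K)
    (hKoG : kolyvagin N' G K) (hGZG : gross_zagier N' G K)
    (hd : NumberField.discr K < -4)
    (hGd : ∃ C : VariableChange ℚ, C • G.quadraticTwist (NumberField.discr K : ℚ) = Gd)
    (H : HeegnerDatum N (NumberField.discr K)) (H' : HeegnerDatum N' (NumberField.discr K))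
    (ι : K →+* ℂ) (ι₃ : K →+* ℚ_[3])
    (P : (W.baseChange K).toAffine.Point) (P' Q : (G.baseChange K).toAffine.Point)
    (hP : WeierstrassCurve.Affine.Point.map ι.toRatAlgHom P = heegnerPointComplex D H)
    (hP' : WeierstrassCurve.Affine.Point.map ι.toRatAlgHom P' = heegnerPointComplex D' H')
    (hPinf : ¬ IsOfFinAddOrder P) (hP'inf : ¬ IsOfFinAddOrder P') (hQ : ¬ IsOfFinAddOrder Q)
    (hQunit : X11b.padicLogOrd G 3 ι₃ Q + padicValInt 3 (nsCount G 3) - 1 = 0)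
    (hSelG : Nat.card (G.selmerGroup (3 : ℤ)) = 3 ^ G.mordellWeilRank)
    (hSelGd : Nat.card (Gd.selmerGroup (3 : ℤ)) = 3 ^ Gd.mordellWeilRank)
    (hcD : padicValInt 3 D.maninConstant = 0) (hc3' : ¬ ((3 : ℤ) ∣ D'.maninConstant)) :
    padicValNat 3 (AddSubgroup.zmultiples P).index = 0 := by
  haveI : Fact (Nat.Prime 3) := ⟨Nat.prime_three⟩
  -- elementary consequences of the binders (as in part 18's `_facts_s0`)
  have h3d : ¬ ((3 : ℤ) ∣ NumberField.discr K) := not_three_dvd_discr_of_split K hK h3K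
  have hμ : ¬ 3 ∣ NumberField.Units.torsionOrder K := not_three_dvd_unitsTorsionOrder_of_discr_lt K hK hd
  have hcD' : padicValInt 3 D'.maninConstant = 0 := padicValInt.eq_zero_of_not_dvd hc3'
  obtain ⟨Cd, hCd⟩ := hGd
  have hu : padicValRat 3 (Cd.u : ℚ) = 0 :=
    AdditivePotMult.padicValRat_u_eq_zero_of_twist_minimal_of_split G 3 K hK h3K Cd hCd
  have hE : hasEntireLFunction_rat := hasEntireLFunction_rat_of_exists_isNewformOf hmod
  have hWa3 : W.LFunction 3 = 0 :=
    W.LFunction_apply_eq_zero_of_not_good_of_not_mult 3 hadd.1 hadd.2 (dvd_refl 3)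
  have hNW : W.conductorNorm ℤ ≠ 0 := (W.conductorNorm_pos_holds).ne'
  have hNG : G.conductorNorm ℤ ≠ 0 := (G.conductorNorm_pos_holds).ne'
  have hN' : N' = G.conductorNorm ℤ :=
    IsNewformOf.level_eq_conductorNorm_of_exists_isNewformOf hmod D'.isNewformOf
  have hHG : SatisfiesHeegnerHypothesis (G.conductorNorm ℤ) K := hN' ▸ hH'
  -- class-level discharges: row C16 for the companion pair, analytic ranks ≤ 1 (GEN 19)
  have hC16 : RowC16 G 3 := rowC16_three_of_goodOrd_of_isCongruentModThree W G hcong hρ hordG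
  have hC16d : RowC16 Gd 3 := rowC16_three_twist_of_heegner G Gd K hK hHG h3d ⟨Cd, hCd⟩ hC16
  obtain ⟨hrG, hrGd⟩ := analyticRank_pair_le_one_of_heegner_nonTorsion hmod G D' K hK hH' hGZG Gd ⟨Cd, hCd⟩
    ⟨D', H', ι, hP'⟩ hP'inf
  haveI : Finite G.sha := (hGZK G hrG).2
  haveI : Finite Gd.sha := (hGZK Gd hrGd).2
  -- STEP-0 (GEN 22): the two analytic orders are rational (Yan–Zhu on row C16) and part 17's identity
  obtain ⟨q₀, hq₀, -⟩ := missingPPartAt_of_bsdp G 3 (RowC16.bsdp hYZ hW20 hE hGZK hrG hC16)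
  obtain ⟨q₁, hq₁, -⟩ := missingPPartAt_of_bsdp Gd 3 (RowC16.bsdp hYZ hW20 hE hGZK hrGd hC16d)
  have hstep0 := stepZero_three_of_heegner_pair G N' K D' H' ι P' hGZG hKoG hGZK hE hK hH' hP' hP'inf
    hc3' hμ hrG Gd Cd hCd hu hrGd htamG htamGd hq₀ hq₁
  -- `#Ш(G/K)[3^∞] = 1` from the companion pair's two 3-descents (part 19), torsion from row C16
  have hsha : Nat.card (AddCommGroup.primaryComponent (G.baseChange K).sha 3) = 1 :=
    hshaW_of_threeDescent G K hK Gd ⟨Cd, hCd⟩ (Supersingular.not_dvd_torsionOrder_of_irr G 3 hC16.2.2.1)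
      (Supersingular.not_dvd_torsionOrder_of_irr Gd 3 hC16d.2.2.1) hSelG hSelGd
  -- the Heegner point of the companion has finite index (Kolyvagin)
  have hI0 : (AddSubgroup.zmultiples P').index ≠ 0 :=
    index_zmultiples_ne_zero_of_kolyvagin G K hKoG hK hH' ⟨D', H', ι, hP'⟩ hP'inf
  -- companion side (GEN 18): the Kriz–Li-normalised Heegner log of `G` is a `3`-adic unit
  have hGunit : X11b.padicLogOrd G 3 ι₃ P' + padicValInt 3 (nsCount G 3) - 1 = 0 :=
    goodOrd_companion_logUnit_three_of_sha hYZ hW20 hE hGZK G hrG hC16 Gd hrGd hC16d K hK ⟨Cd, hCd⟩ ι₃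
      P' Q hP'inf hQ hI0 hQunit D' hq₀ hq₁ hstep0 hsha htamG hcD'
  -- W side (GEN 16) with KL3-A := Kriz–Li Thm. 1.16 by name (part 14)
  exact padicValNat_index_eq_zero_of_companion_unit'
    (krizLiUnitBitTransportThree_of_thm116_of_exists_isNewformOf hKL hmod) W G hcong hρ hadd hWa3 hNW hNG
    hunitW hunitG htam D D' K hK hH hH' hd h3d H H' ι ι₃ P P' hP hP' hPinf hP'inf hcD hcD' hGunit

/-! ## §2 The same END with the unit-log datum a RATIONAL point of the companion (part 12) -/

/-- **Two-sided END, certificate form of the unit-log binder.** §1 with `Q`, `hQ`, `hQunit` replaced by a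
rational point `Q₀ ∈ G(ℚ)` of infinite order whose `ℤ₃`-linearly extended formal-group logarithm at the
`ℚ₃`-point `Q₀ ⊗ ℚ₃` has valuation `1 − v₃ |G̃(𝔽₃)|` (the least value it can take; `= 1` at a non-anomalous
good ordinary `3`, `= 0` at an anomalous one) — a statement about `Q₀` alone, decidable per row from the
coordinates of `|G̃(𝔽₃)| • Q₀` (read in `G(K)` along `ι₃` by part 12's
`padicLogOrd_map_ofId_eq_valuation_padicLog`). [cite: KrizLi2019, Thm. 1.16, Rem. 1.17]
[cite: Castella2018, §2.2 and Thm. 2.3 (arXiv:1704.06608 p. 5)] [cite: YanZhu2024MainConjNonCM, Thm. 4.15 (§4.6) = Cor. 1.4]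
[cite: JetchevSkinnerWan2017, §7.4.1 (arXiv:1512.06894 p. 30)] -/
theorem o5_index_unit_of_goodOrd_companion_cited_s0d_rat
    (hKL : KrizLi2019.thm116_padicLogHeegner_congruence)
    (hYZ : YanZhu2026.thm415_padicValRat_bsd_rank_le_one)
    (hW20 : Wuthrich2014.lemma20_surjective_threeAdic_of_semistable)
    (hmod : exists_isNewformOf) (hGZK : rank_eq_analyticRank_of_analyticRank_le_one)
    (W G : WeierstrassCurve ℚ) [W.IsElliptic] [W.IsGloballyMinimal] [G.IsElliptic] [G.IsGloballyMinimal]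
    (hcong : ∀ ℓ : ℕ, ℓ.Prime → ¬ (ℓ ∣ 3 * W.conductorNorm ℤ * G.conductorNorm ℤ) →
      ((W.LFunction ℓ : ℤ) : ZMod 3) = ((G.LFunction ℓ : ℤ) : ZMod 3))
    (hρ : W.HasSurjectiveModNGaloisRep 3) (hadd : Addv W 3)
    (hunitW : ∀ ℓ ∈ klSet W G, ℓ ≠ 3 → padicValInt 3 (nsCount W ℓ) = 0)
    (hunitG : ∀ ℓ ∈ klSet G W, ℓ ≠ 3 → padicValInt 3 (nsCount G ℓ) = 0)
    (htam : ¬ 3 ∣ W.tamagawaProduct) (htamG : ¬ 3 ∣ G.tamagawaProduct) (hordG : GoodOrd G 3)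
    (Gd : WeierstrassCurve ℚ) [Gd.IsElliptic] [Gd.IsGloballyMinimal] (htamGd : ¬ 3 ∣ Gd.tamagawaProduct)
    {N N' : ℕ} [NeZero N] [NeZero N'] (D : ModularParametrizationData W N)
    (D' : ModularParametrizationData G N')
    (K : Type) [Field K] [NumberField K] (hK : IsImaginaryQuadratic K)
    (hH : SatisfiesHeegnerHypothesis N K) (hH' : SatisfiesHeegnerHypothesis N' K)
    (h3K : SatisfiesHeegnerHypothesis 3 K)
    (hKoG : kolyvagin N' G K) (hGZG : gross_zagier N' G K)
    (hd : NumberField.discr K < -4)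
    (hGd : ∃ C : VariableChange ℚ, C • G.quadraticTwist (NumberField.discr K : ℚ) = Gd)
    (H : HeegnerDatum N (NumberField.discr K)) (H' : HeegnerDatum N' (NumberField.discr K))
    (ι : K →+* ℂ) (ι₃ : K →+* ℚ_[3])
    (P : (W.baseChange K).toAffine.Point) (P' : (G.baseChange K).toAffine.Point)
    (hP : WeierstrassCurve.Affine.Point.map ι.toRatAlgHom P = heegnerPointComplex D H)
    (hP' : WeierstrassCurve.Affine.Point.map ι.toRatAlgHom P' = heegnerPointComplex D' H')
    (hPinf : ¬ IsOfFinAddOrder P) (hP'inf : ¬ IsOfFinAddOrder P')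
    (Q₀ : G.toAffine.Point) (hQ₀ : ¬ IsOfFinAddOrder Q₀)
    (hQ₀unit : (padicLog (G.baseChange ℚ_[3])
        (Affine.Point.map (W' := G.toAffine) (S := ℚ) (Algebra.ofId ℚ ℚ_[3]) Q₀)).valuation +
      padicValInt 3 (nsCount G 3) - 1 = 0)
    (hSelG : Nat.card (G.selmerGroup (3 : ℤ)) = 3 ^ G.mordellWeilRank)
    (hSelGd : Nat.card (Gd.selmerGroup (3 : ℤ)) = 3 ^ Gd.mordellWeilRank)
    (hcD : padicValInt 3 D.maninConstant = 0) (hc3' : ¬ ((3 : ℤ) ∣ D'.maninConstant)) :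
    padicValNat 3 (AddSubgroup.zmultiples P).index = 0 := by
  haveI : Fact (Nat.Prime 3) := ⟨Nat.prime_three⟩
  have hQ : ¬ IsOfFinAddOrder (Affine.Point.map (W' := G.toAffine) (S := ℚ) (Algebra.ofId ℚ K) Q₀) :=
    not_isOfFinAddOrder_map_ofId G Q₀ hQ₀
  have hQunit : X11b.padicLogOrd G 3 ι₃ (Affine.Point.map (W' := G.toAffine) (S := ℚ) (Algebra.ofId ℚ K) Q₀) +
      padicValInt 3 (nsCount G 3) - 1 = 0 := by
    rw [padicLogOrd_map_ofId_eq_valuation_padicLog G 3 ι₃ Q₀ hQ₀]; exact hQ₀unit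
  exact o5_index_unit_of_goodOrd_companion_cited_s0d hKL hYZ hW20 hmod hGZK W G hcong hρ hadd hunitW hunitG
    htam htamG hordG Gd htamGd D D' K hK hH hH' h3K hKoG hGZG hd hGd H H' ι ι₃ P P' _ hP hP' hPinf hP'inf hQ
    hQunit hSelG hSelGd hcD hc3'

end Summit.BirchSwinnertonDyer.Rank1Residual.O5.HeegnerLogTransport

end
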